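import Mathlib
import Summits.NavierStokesRegularity.FluidComputer.TorusHighBandCeiling
import HarnessLib

/-!
# The high-band CEILING along a Leray–Hopf solution of the periodic Navier–Stokes equations

HONEST FRAMING (cell `ns-blowup`, seat `ns-blowup-circuit` g6, human ruling D-0035): nothing here is a
claim about Navier–Stokes blow-up. WHAT THIS IS NOT: not a regularity criterion, not blow-up evidence.
Part 3 of `TorusHighBandFluxCeiling` (p445097) / `TorusHighBandCeiling` (p445831): the pointwise
ceiling for the TRUE Navier–Stokes equations on `T^d`. For a Leray–Hopf solution `u` (`ν > 0`,
`f ∈ L¹(0,T;L²)`) whose high-band energy `e_M(s) = ½‖Q_M u(s)‖²` is continuous on `[0,T]` (classical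
solutions; energy-equality classes), and any level `G` with `K_M(u(s))‖u(s)‖₂ + ‖f(s)‖₂ ≤ G` for a.e.
`s ∈ (0,T)` (`K_M = Torus.truncDerivBound M`, the low-band ℓ¹-strain; `‖·‖₂ = (∫‖·‖²)^{1/2}`):

* `highBand_ceiling` — **`‖Q_M u(t)‖₂ ≤ max(‖Q_M u(0)‖₂, G / (4π²ν(M²+1)))` for all `t ∈ [0,T]`**
  (budget from a.e. time `highBand_energy_budget_ae` + slice bound `highBand_source_le` + time tail
  Poincaré `lintegral_highBand_le_lintegral_tail` + the crossing lemma
  `sqrt_le_max_of_ae_integral_ineq`) — the analogue, for NS itself, of the Galerkin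
  `GalerkinFluxCeiling.sqrt_outsideEnergy_le_max` (p437361);
* `lowStrain_large_of_highBand_growth` — contrapositive: if at some `t ∈ [0,T]` the high band exceeds
  `max(‖Q_M u(0)‖₂, X)`, then `K_M(u(s))‖u(s)‖₂ + ‖f(s)‖₂ > 4π²ν(M²+1)·X` on a set of times
  `s ∈ (0,T)` of positive measure (`∃ᵐ`).

READING (memo `CIRCUIT-OBSTRUCTIONS.md` §E.3b, for NS itself): a cascade step that lifts the energy
above wavenumber `M` over its initial level must be driven, at some earlier times, by a low-band
ℓ¹-strain `K_M ≳ 4π²νM²·X/‖u‖₂` — the «coherence law» `G_n ≥ νN_n/√E_n`, kernel-checked for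
Leray–Hopf solutions of the periodic Navier–Stokes equations. No definitions.
-/

noncomputable section

open MeasureTheory Set Filter UnitAddTorus Function
open scoped ENNReal NNReal InnerProductSpace RealInnerProductSpace Topology

namespace Summit.NavierStokesRegularity.FluidComputer.TorusHighBandFluxCeiling

open Literature.Analysis Literature.Analysis.FunctionSpaces Literature.Analysis.FluidPDE

variable {d : Type*} [Fintype d] [DecidableEq d]

section Flow

variable {T ν : ℝ} {f u : ℝ → UnitAddTorus d → EuclideanSpace ℝ d}

omit [DecidableEq d] in
/-- `2·(½∫‖v‖²) = ∫‖v‖²`. [folklore] -/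
theorem two_mul_kineticEnergy (v : UnitAddTorus d → EuclideanSpace ℝ d) :
    2 * Torus.kineticEnergy v = ∫ x, ‖v x‖ ^ 2 := by
  unfold Torus.kineticEnergy; ring

/-- **THE HIGH-BAND CEILING for Leray–Hopf solutions of the periodic Navier–Stokes equations.**
Let `u` be a Leray–Hopf solution on `T^d × [0,T)` with datum `u(0)`, `T > 0`, `ν > 0`, jointly
measurable `f ∈ L¹(0,T;L²)`; let `M` be a band edge and `G` a level with
`K_M(u(s))·‖u(s)‖₂ + ‖f(s)‖₂ ≤ G` for a.e. `s ∈ (0,T)`; assume the high-band energy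
`s ↦ ½‖Q_M u(s)‖²` is continuous on `[0,T]`. Then for every `t ∈ [0,T]`
`‖Q_M u(t)‖₂ ≤ max(‖Q_M u(0)‖₂, G / (4π²ν(M²+1)))`. [folklore; the true-NS twin of the Galerkin
`GalerkinFluxCeiling.sqrt_outsideEnergy_le_max`] -/
theorem highBand_ceiling (hu : FluidPDE.Torus.IsLerayHopfOn T ν f (u 0) u) (hT : 0 < T)
    (hfm : AEStronglyMeasurable (Torus.stLift f) (volume.restrict (Ioo 0 T ×ˢ univ)))
    (hf : FluidPDE.Torus.MemLqLp 1 2 f (Ioo 0 T)) (hν : 0 < ν) (M : ℕ) {G : ℝ}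
    (hG : ∀ᵐ s ∂(volume.restrict (Ioo 0 T)),
      FluidPDE.Torus.truncDerivBound M (u s) * Real.sqrt (∫ x, ‖u s x‖ ^ 2) +
        Real.sqrt (∫ x, ‖f s x‖ ^ 2) ≤ G)
    (hcont : ContinuousOn (fun s => Torus.kineticEnergy (u s - Torus.fourierTruncate M (u s))) (Icc 0 T)) :
    ∀ t ∈ Icc 0 T, Real.sqrt (2 * Torus.kineticEnergy (u t - Torus.fourierTruncate M (u t))) ≤
      max (Real.sqrt (2 * Torus.kineticEnergy (u 0 - Torus.fourierTruncate M (u 0))))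
        (G / (4 * Real.pi ^ 2 * ν * ((M : ℝ) ^ 2 + 1))) := by
  classical
  set e : ℝ → ℝ := fun s => Torus.kineticEnergy (u s - Torus.fourierTruncate M (u s)) with he_def
  set lam : ℝ := 4 * Real.pi ^ 2 * ν * ((M : ℝ) ^ 2 + 1) with hlam_def
  have hlam : 0 < lam := by positivity
  have hmem : ∀ s ∈ Icc 0 T, MemLp (u s) 2 volume := hu.memLp
  have hu0 : MemLp (u 0) 2 volume := hmem 0 ⟨le_rfl, hT.le⟩
  have he : ∀ t ∈ Icc 0 T, 0 ≤ e t := fun t _ => by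
    simp only [he_def, Torus.kineticEnergy]
    exact mul_nonneg (by norm_num) (integral_nonneg fun x => by positivity)
  have hB := highBand_energy_budget_ae hu hT hfm hf hu0 M
  -- ### the integral inequality from a.e. `s₀`
  have H : ∀ᵐ s₀ ∂(volume.restrict (Ioo 0 T)), ∀ t ∈ Icc s₀ T,
      e t ≤ e s₀ + ∫ s in Ioc s₀ t, (G * Real.sqrt (2 * e s) - 2 * lam * e s) := by
    filter_upwards [hB, ae_restrict_mem measurableSet_Ioo] with s₀ hBs₀ hs₀
    intro t ht
    obtain ⟨hInt, hbud⟩ := hBs₀ t ht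
    have hsub : Ioo s₀ t ⊆ Ioo 0 T := Ioo_subset_Ioo hs₀.1.le ht.2
    have hle : volume.restrict (Ioo s₀ t) ≤ volume.restrict (Ioo 0 T) :=
      Measure.restrict_mono hsub le_rfl
    have hleC : volume.restrict (Ioc s₀ t) ≤ volume.restrict (Ioo 0 T) := by
      rw [← Measure.restrict_congr_set Ioo_ae_eq_Ioc]; exact hle
    -- continuity ⇒ integrability of the comparison integrands on `(s₀, t]`
    have hcI : ContinuousOn e (Icc s₀ t) := hcont.mono (Icc_subset_Icc hs₀.1.le ht.2)
    have hcG : ContinuousOn (fun s => G * Real.sqrt (2 * e s)) (Icc s₀ t) :=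
      continuousOn_const.mul (Real.continuous_sqrt.comp_continuousOn (continuousOn_const.mul hcI))
    have hIe : IntegrableOn e (Ioc s₀ t) := hcI.integrableOn_Icc.mono_set Ioc_subset_Icc_self
    have hIG : IntegrableOn (fun s => G * Real.sqrt (2 * e s)) (Ioc s₀ t) :=
      hcG.integrableOn_Icc.mono_set Ioc_subset_Icc_self
    -- (i) the source is dominated slice-wise
    have hsrc : ∫ s in Ioc s₀ t, ((∫ x, ⟪f s x, u s x - Torus.fourierTruncate M (u s) x⟫) -
        ∫ x, ⟪u s x - Torus.fourierTruncate M (u s) x,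
          Torus.convect (u s) (Torus.fourierTruncate M (u s)) x⟫) ≤
        ∫ s in Ioc s₀ t, G * Real.sqrt (2 * e s) := by
      refine integral_mono_ae hInt hIG ?_
      filter_upwards [ae_mono hleC hG, ae_mono hleC hf.1, ae_restrict_mem measurableSet_Ioc]
        with s hGs hfs hs
      have hus : MemLp (u s) 2 volume := hmem s ⟨(hs₀.1.trans hs.1).le, hs.2.trans ht.2⟩
      have h1 := highBand_source_le hus hfs M
      have h2 : Real.sqrt (∫ x, ‖u s x - Torus.fourierTruncate M (u s) x‖ ^ 2) =
          Real.sqrt (2 * e s) := by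
        rw [he_def]; dsimp only; rw [two_mul_kineticEnergy]; rfl
      rw [h2] at h1
      exact h1.trans (mul_le_mul_of_nonneg_right hGs (Real.sqrt_nonneg _))
    -- (ii) the dissipation dominates `2·lam·∫ e`
    have hTfin : ∫⁻ s in Ioo s₀ t, FluidPDE.Torus.tailGradNormSq M (u s) ≠ ⊤ := by
      refine ne_top_of_le_ne_top
        ((lintegral_mono' hle le_rfl).trans_lt hu.lintegral_eGradNormSq_lt_top).ne ?_
      exact lintegral_mono fun s => FluidPDE.Torus.tailGradNormSq_le M (u s)
    have hdis : 4 * Real.pi ^ 2 * ((M : ℝ) ^ 2 + 1) * ∫ s in Ioc s₀ t, (2 * e s) ≤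
        (∫⁻ s in Ioo s₀ t, FluidPDE.Torus.tailGradNormSq M (u s)).toReal := by
      have hP : ENNReal.ofReal (4 * Real.pi ^ 2) * ENNReal.ofReal ((M : ℝ) ^ 2 + 1) *
          ∫⁻ s in Ioo s₀ t, ∫⁻ x, ‖Torus.fourierTruncate M (u s) x - u s x‖ₑ ^ 2 ≤
          ∫⁻ s in Ioo s₀ t, FluidPDE.Torus.tailGradNormSq M (u s) := by
        rw [← lintegral_const_mul' _ _
          (ENNReal.mul_ne_top ENNReal.ofReal_ne_top ENNReal.ofReal_ne_top)]
        refine setLIntegral_mono' measurableSet_Ioo fun s hs => ?_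
        exact FluidPDE.Torus.lintegral_enorm_sq_fourierTruncate_sub_le
          (hmem s ⟨(hs₀.1.trans hs.1).le, hs.2.le.trans ht.2⟩) M
      -- identify `∫⁻∫⁻‖P u - u‖ₑ²` with `ofReal ∫ 2e`
      have hslice : ∀ s ∈ Ioo s₀ t, ∫⁻ x, ‖Torus.fourierTruncate M (u s) x - u s x‖ₑ ^ 2 =
          ENNReal.ofReal (2 * e s) := by
        intro s hs
        have hus : MemLp (u s) 2 volume := hmem s ⟨(hs₀.1.trans hs.1).le, hs.2.le.trans ht.2⟩
        have hsub' : MemLp (u s - Torus.fourierTruncate M (u s)) 2 volume :=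
          hus.sub (Torus.memLp_fourierTruncate M (u s) 2)
        rw [he_def]; dsimp only
        rw [two_mul_kineticEnergy, FluidPDE.Torus.ofReal_integral_norm_sq_eq_lintegral hsub']
        refine lintegral_congr fun x => ?_
        rw [Pi.sub_apply, enorm_sub_rev]
      have h2e : IntegrableOn (fun s => 2 * e s) (Ioo s₀ t) :=
        (hIe.mono_set Ioo_subset_Ioc_self).const_mul 2
      have hlin : ∫⁻ s in Ioo s₀ t, ∫⁻ x, ‖Torus.fourierTruncate M (u s) x - u s x‖ₑ ^ 2 =
          ENNReal.ofReal (∫ s in Ioo s₀ t, 2 * e s) := by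
        rw [setLIntegral_congr_fun measurableSet_Ioo hslice,
          ofReal_integral_eq_lintegral_ofReal h2e]
        filter_upwards [ae_restrict_mem measurableSet_Ioo] with s hs
        exact mul_nonneg zero_le_two (he s ⟨(hs₀.1.trans hs.1).le, hs.2.le.trans ht.2⟩)
      rw [hlin, ← ENNReal.ofReal_mul (by positivity), ← ENNReal.ofReal_mul (by positivity),
        ENNReal.ofReal_le_iff_le_toReal hTfin, setIntegral_congr_set Ioo_ae_eq_Ioc] at hP
      exact hP
    -- (iii) combine
    have hsplit : ∫ s in Ioc s₀ t, (G * Real.sqrt (2 * e s) - 2 * lam * e s) =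
        (∫ s in Ioc s₀ t, G * Real.sqrt (2 * e s)) - 2 * lam * ∫ s in Ioc s₀ t, e s := by
      have hIe2 : Integrable (fun s => 2 * lam * e s) (volume.restrict (Ioc s₀ t)) :=
        hIe.const_mul (2 * lam)
      rw [integral_sub hIG hIe2]
      congr 1
      exact integral_const_mul _ _
    have h2int : ∫ s in Ioc s₀ t, (2 * e s) = 2 * ∫ s in Ioc s₀ t, e s := integral_const_mul 2 _
    rw [hsplit]
    rw [h2int] at hdis
    have hlamid : 2 * lam * ∫ s in Ioc s₀ t, e s =
        ν * (4 * Real.pi ^ 2 * ((M : ℝ) ^ 2 + 1) * (2 * ∫ s in Ioc s₀ t, e s)) := by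
      rw [hlam_def]; ring
    have hνdis := mul_le_mul_of_nonneg_left hdis hν.le
    change e t + ν * (∫⁻ s in Ioo s₀ t, FluidPDE.Torus.tailGradNormSq M (u s)).toReal ≤ e s₀ + _ at hbud
    linarith [hbud, hsrc, hνdis, hlamid]
  exact sqrt_le_max_of_ae_integral_ineq hlam hcont he H

/-- **Contrapositive — the coherence law for NS itself.** In the setting of `highBand_ceiling`, let
`X ∈ ℝ`. If at some `t ∈ [0,T]` the high band exceeds both its initial size and `X`,
`‖Q_M u(t)‖₂ > max(‖Q_M u(0)‖₂, X)`, then the low-band ℓ¹-strain plus forcing exceeded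
`4π²ν(M²+1)·X` on a set of earlier times of positive measure:
`∃ᵐ s ∈ (0,T), 4π²ν(M²+1)·X < K_M(u(s))‖u(s)‖₂ + ‖f(s)‖₂`. [folklore] -/
theorem lowStrain_large_of_highBand_growth (hu : FluidPDE.Torus.IsLerayHopfOn T ν f (u 0) u)
    (hT : 0 < T)
    (hfm : AEStronglyMeasurable (Torus.stLift f) (volume.restrict (Ioo 0 T ×ˢ univ)))
    (hf : FluidPDE.Torus.MemLqLp 1 2 f (Ioo 0 T)) (hν : 0 < ν) (M : ℕ)
    (hcont : ContinuousOn (fun s => Torus.kineticEnergy (u s - Torus.fourierTruncate M (u s))) (Icc 0 T))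
    {X t : ℝ} (ht : t ∈ Icc 0 T)
    (hgrow : max (Real.sqrt (2 * Torus.kineticEnergy (u 0 - Torus.fourierTruncate M (u 0)))) X <
      Real.sqrt (2 * Torus.kineticEnergy (u t - Torus.fourierTruncate M (u t)))) :
    ∃ᵐ s ∂(volume.restrict (Ioo 0 T)),
      4 * Real.pi ^ 2 * ν * ((M : ℝ) ^ 2 + 1) * X <
        FluidPDE.Torus.truncDerivBound M (u s) * Real.sqrt (∫ x, ‖u s x‖ ^ 2) +
          Real.sqrt (∫ x, ‖f s x‖ ^ 2) := by
  by_contra hno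
  rw [Filter.not_frequently] at hno
  have hG : ∀ᵐ s ∂(volume.restrict (Ioo 0 T)),
      FluidPDE.Torus.truncDerivBound M (u s) * Real.sqrt (∫ x, ‖u s x‖ ^ 2) +
        Real.sqrt (∫ x, ‖f s x‖ ^ 2) ≤ 4 * Real.pi ^ 2 * ν * ((M : ℝ) ^ 2 + 1) * X :=
    hno.mono fun s hs => not_lt.1 hs
  have h := highBand_ceiling hu hT hfm hf hν M hG hcont t ht
  have hlam : 0 < 4 * Real.pi ^ 2 * ν * ((M : ℝ) ^ 2 + 1) := by positivity
  rw [mul_div_cancel_left₀ X hlam.ne'] at h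
  exact absurd (hgrow.trans_le h) (lt_irrefl _)

end Flow

end Summit.NavierStokesRegularity.FluidComputer.TorusHighBandFluxCeiling
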